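import Summits.Ventures.YMGap.Thresholds.StarFront
import Literature.MathematicalPhysics.QuantumLattice.LatticeGaugeDLRGibbsProofs
import Literature.MathematicalPhysics.QuantumLattice.LatticeGaugeDLRFarFactorProofs
import Literature.MathematicalPhysics.QuantumFieldTheory.LatticeGaugeDobrushin
import HarnessLib

/-!
# Venture YMGap — track (c) «DS»: infinite-volume limit states — the one-torus star door for `ℤ⁴`
# cylinder observables and the weak-limit step (tools for `StarLimitStates.lean`)

HONEST FRAMING: venture file (cell `pub-ymgap`, PLAN R99/R101/R102), strong-coupling LATTICE
bookkeeping only.  INPUT: the hypothesis schema `StarWindowBound L β_W ρ r` of `StarWindow.lean` on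
all large tori with ONE received sum `ρ < 1` (the cell's Lemma G proposes an instance; its Lean
assembly is ds-4's `StarLemmaG` chain, NOT this file).  OUTPUT, kernel-checked GIVEN that input: a
covariance bound for two bounded CONTINUOUS cylinder observables of `ℤ⁴` under any infinite-volume
limit state `μ` of the torus Wilson states (`IsInfiniteVolumeLimitAlong`, subsequence `L_k + 1`),
`|μ(Φ₁Φ₂) − μ(Φ₁)μ(Φ₂)| ≤ 32 e^{−κ(ρ)(‖x‖_∞ − D − 4)} (#T₁·J·M₁E)(#T₂·J·M₂E)` when the supports are
`‖x‖_∞ ≥ D + 4` apart (`su2Star_limit_far_bound`): the torus covariances converge to the covariance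
under `μ` (definition of the limit), and each obeys ds-1's one-torus star door
`DSWindow.su2Star_abs_integral_mul_sub_le` (`StarFrontTorus.lean`) with the `StarFront` geometry
(`su2Star_torus_far_bound`).  Also: the Feller property of the `ℤ^d` lattice Yang–Mills kernels for
bounded MEASURABLE observables living inside the volume (`continuous_specAvg_ymSpecification`) and
collar bookkeeping on `ℤ^d` (`card_collar_le`, `exists_near_of_mem_union_collar`,
`card_union_collar_le`, `supNorm_le_of_mem_union_collar`).  Nothing about uniqueness of the DLR state,
the continuum, confinement or a transfer-matrix gap.

References: cell files `GAUGE-STAR.md` (ds-2), `LEAN-KROW.md` (ds-1); H. Föllmer, LNM 1362 (1988)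
Ch. I Thm. (2.13); H.-O. Georgii, Gibbs Measures and Phase Transitions (2011) Def. 4.11, Thm. 4.17.
-/

noncomputable section

open MeasureTheory ProbabilityTheory Function Finset Filter Topology
open Literature.Probability.LatticeModels
open Literature.Probability.LatticeModels.DobrushinMetric
open Literature.MathematicalPhysics.QuantumLattice (toTorusObservable toTorusObservable_apply IsCylinder
  LGConfig torusLift torusEdge fundamentalRep fundamentalLatticeRep
  configShift_apply infiniteVolumeLimitPoints IsInfiniteVolumeLimitAlong ymSpecification ymGibbsMeasures plaquettesTouching
  plaquetteEdges mem_plaquettesTouching_iff wilsonBoundaryAction continuous_fundamentalRep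
  integral_ymSpecification continuous_integral_glueWith normaliser_pos exists_bound_of_continuous
  continuous_glueWith_prod dependsOn_integral_ymSpecification continuous_wilsonBoundaryAction
  mem_ymGibbsMeasures_of_mem_infiniteVolumeLimitPoints_holds
  exists_near_of_mem_plaquettesTouching_biUnion IsZdGaugeInvariant)
open Literature.MathematicalPhysics.QuantumFieldTheory
open Literature.MathematicalPhysics.QuantumFieldTheory.Balaban1983to89
open Literature.MathematicalPhysics.QuantumFieldTheory.Balaban1983to89.StrongCouplingTorusWindow
open Summit.Ventures.YMGap.DSWindow

namespace Summit.Ventures.YMGap.StarLimit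

/-! ### The Feller property for measurable observables measurable inside the volume -/

section Feller

variable {d N : ℕ} {G : Type*} [Group G] [TopologicalSpace G] [IsTopologicalGroup G]
  [CompactSpace G] [MeasurableSpace G] [BorelSpace G] [SecondCountableTopology G]
  (ρ : G →* Matrix (Fin N) (Fin N) ℂ)

/-- **Feller property of the lattice Yang–Mills kernels for observables living inside the volume**:
for a bounded MEASURABLE `F` depending only on the links of `Λ`, the DLR smoothing
`η ↦ γ_Λ F(η) = ∫ F dγ_Λ(· | η)` of the `ℤ^d` specification `ymSpecification ρ β` is CONTINUOUS in
the boundary condition: `F(ζ ∨ η)` does not depend on `η`, and the tilting density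
`exp(−β S_Λ(ζ ∨ η))` is jointly continuous and bounded (dominated convergence on the compact fibre
`G^Λ`; normaliser positive). (Georgii 2011 Def. 4.11 ff.; the tree's
`continuous_integral_ymSpecification` is the case of continuous `F`.) -/
theorem continuous_specAvg_ymSpecification (hρ : Continuous ρ) (β : ℝ) (Λ : Finset (Literature.MathematicalPhysics.QuantumLattice.ZdEdge d))
    {F : LGConfig d G → ℝ} (hFm : Measurable F) (hFdep : DependsOn F (↑Λ : Set (Literature.MathematicalPhysics.QuantumLattice.ZdEdge d)))
    {C : ℝ} (hC : ∀ U, |F U| ≤ C) :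
    Continuous (specAvg (ymSpecification ρ β) Λ F) := by
  have hw : Continuous fun U : LGConfig d G => Real.exp (-β * wilsonBoundaryAction ρ Λ U) :=
    Real.continuous_exp.comp (continuous_const.mul (continuous_wilsonBoundaryAction ρ hρ Λ))
  obtain ⟨B, hB⟩ := exists_bound_of_continuous hw
  -- `F (ζ ∨ η)` does not depend on the boundary condition `η`
  have hFglue : ∀ (ζ : ↥Λ → G) (η : LGConfig d G),
      F (glueWith Λ ζ η) = F (glueWith Λ ζ (1 : LGConfig d G)) := fun ζ η =>
    hFdep fun e he => by
      rw [glueWith_apply_mem _ _ _ (Finset.mem_coe.1 he), glueWith_apply_mem _ _ _ (Finset.mem_coe.1 he)]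
  -- the numerator is continuous in `η` by dominated convergence
  have hnum : Continuous fun η : LGConfig d G =>
      ∫ ζ, F (glueWith Λ ζ (1 : LGConfig d G)) *
          Real.exp (-β * wilsonBoundaryAction ρ Λ (glueWith Λ ζ η))
        ∂(Measure.pi fun _ : ↥Λ => haarProbability G) := by
    refine continuous_of_dominated (fun η => ?_) (fun η => ae_of_all _ fun ζ => ?_)
      (integrable_const (C * B)) (ae_of_all _ fun ζ => ?_)
    · exact ((hFm.comp (measurable_glueWith Λ (1 : LGConfig d G))).mul
        (hw.measurable.comp (measurable_glueWith Λ η))).aestronglyMeasurable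
    · rw [Real.norm_eq_abs, abs_mul]
      exact mul_le_mul (hC _) (hB _) (abs_nonneg _)
        ((abs_nonneg _).trans (hC (glueWith Λ ζ (1 : LGConfig d G))))
    · exact continuous_const.mul
        (hw.comp ((continuous_glueWith_prod Λ).comp (Continuous.prodMk_left ζ)))
  -- the normaliser is continuous and positive
  have hden : Continuous fun η : LGConfig d G =>
      ∫ ζ, Real.exp (-β * wilsonBoundaryAction ρ Λ (glueWith Λ ζ η))
        ∂(Measure.pi fun _ : ↥Λ => haarProbability G) := by
    have h := continuous_integral_glueWith ρ hρ β Λ (F := fun _ => (1 : ℝ)) continuous_const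
      (C := 1) (fun _ => by simp)
    simpa using h
  have heq : specAvg (ymSpecification ρ β) Λ F = fun η =>
      (∫ ζ, F (glueWith Λ ζ (1 : LGConfig d G)) *
          Real.exp (-β * wilsonBoundaryAction ρ Λ (glueWith Λ ζ η))
        ∂(Measure.pi fun _ : ↥Λ => haarProbability G)) /
        ∫ ζ, Real.exp (-β * wilsonBoundaryAction ρ Λ (glueWith Λ ζ η))
          ∂(Measure.pi fun _ : ↥Λ => haarProbability G) := by
    funext η
    rw [specAvg, integral_ymSpecification ρ hρ β Λ hFm η]
    congr 1
    refine integral_congr_ae (ae_of_all _ fun ζ => ?_)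
    dsimp only
    rw [hFglue ζ η]
  rw [heq]
  exact hnum.div hden fun η => (normaliser_pos ρ hρ β Λ η).ne'

end Feller

/-! ### Collar bookkeeping on `ℤ^d` -/

section Collar

variable {d : ℕ}

/-- The collar of a finite link set `Λ` of `ℤ^d` (the links of the plaquettes touching `Λ`) has at
most `4 · 2(d−1) · #Λ` links. -/
theorem card_collar_le (Λ : Finset (Literature.MathematicalPhysics.QuantumLattice.ZdEdge d)) :
    ((plaquettesTouching Λ).biUnion plaquetteEdges).card ≤ 4 * (2 * (d - 1)) * Λ.card := by
  classical
  have hsub : plaquettesTouching Λ ⊆ Λ.biUnion fun e => plaquettesTouching {e} := by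
    intro p hp
    obtain ⟨e, he⟩ := mem_plaquettesTouching_iff.1 hp
    rw [Finset.mem_inter] at he
    exact Finset.mem_biUnion.2 ⟨e, he.2, mem_plaquettesTouching_iff.2
      ⟨e, Finset.mem_inter.2 ⟨he.1, Finset.mem_singleton_self e⟩⟩⟩
  have hT : (plaquettesTouching Λ).card ≤ Λ.card * (2 * (d - 1)) :=
    calc (plaquettesTouching Λ).card ≤ (Λ.biUnion fun e => plaquettesTouching {e}).card :=
          Finset.card_le_card hsub
      _ ≤ ∑ e ∈ Λ, (plaquettesTouching {e}).card := Finset.card_biUnion_le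
      _ ≤ ∑ _e ∈ Λ, 2 * (d - 1) :=
          Finset.sum_le_sum fun e _ => card_plaquettesTouching_singleton_le e
      _ = Λ.card * (2 * (d - 1)) := by rw [Finset.sum_const, smul_eq_mul]
  have h4 : ∀ p : Literature.MathematicalPhysics.QuantumLattice.ZdPlaquette d, (plaquetteEdges p).card ≤ 4 := fun p => by
    unfold plaquetteEdges
    exact Finset.card_le_four
  calc ((plaquettesTouching Λ).biUnion plaquetteEdges).card
      ≤ ∑ p ∈ plaquettesTouching Λ, (plaquetteEdges p).card := Finset.card_biUnion_le
    _ ≤ ∑ _p ∈ plaquettesTouching Λ, 4 := Finset.sum_le_sum fun p _ => h4 p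
    _ = 4 * (plaquettesTouching Λ).card := by rw [Finset.sum_const, smul_eq_mul, mul_comm]
    _ ≤ 4 * (Λ.card * (2 * (d - 1))) := Nat.mul_le_mul_left 4 hT
    _ = 4 * (2 * (d - 1)) * Λ.card := by ring

/-- Every link of `Λ ∪ collar(Λ)` is based within sup-distance `1` of the base point of a link of
`Λ`. -/
theorem exists_near_of_mem_union_collar {Λ : Finset (Literature.MathematicalPhysics.QuantumLattice.ZdEdge d)} {e : Literature.MathematicalPhysics.QuantumLattice.ZdEdge d}
    (he : e ∈ Λ ∪ (plaquettesTouching Λ).biUnion plaquetteEdges) :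
    ∃ e₀ ∈ Λ, ∀ j, |e.1 j - e₀.1 j| ≤ 1 := by
  rcases Finset.mem_union.1 he with h | h
  · exact ⟨e, h, fun j => by simp⟩
  · exact exists_near_of_mem_plaquettesTouching_biUnion h

/-- `#(Λ ∪ collar Λ) ≤ (1 + 4 · 2(d−1)) · #Λ`. -/
theorem card_union_collar_le (Λ : Finset (Literature.MathematicalPhysics.QuantumLattice.ZdEdge d)) :
    (Λ ∪ (plaquettesTouching Λ).biUnion plaquetteEdges).card ≤ (1 + 4 * (2 * (d - 1))) * Λ.card :=
  calc (Λ ∪ (plaquettesTouching Λ).biUnion plaquetteEdges).card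
      ≤ Λ.card + ((plaquettesTouching Λ).biUnion plaquetteEdges).card := Finset.card_union_le _ _
    _ ≤ Λ.card + 4 * (2 * (d - 1)) * Λ.card := Nat.add_le_add_left (card_collar_le Λ) _
    _ = (1 + 4 * (2 * (d - 1))) * Λ.card := by ring

end Collar

/-! ### One torus: the star door for cylinder observables of `ℤ⁴` read through the periodic lift -/

section Torus

variable {L : ℕ} [NeZero L]

/-- **Far-regime covariance bound on one torus for two `ℤ⁴` cylinder observables** (`SU(2)`,
`d = 4`, torus side `L ≥ 2` carrying `StarWindowBound L β_W ρ suFrobDist`, `ρ < 1`): if `Φ₁, Φ₂`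
are bounded measurable cylinder observables of `ℤ⁴` with supports `T₁, T₂` whose projected base
points are `≥ n − D` apart in the periodic sup-distance, `n ≥ D + 4`, then under the torus Wilson
measure at tree coupling `β_W/2`
`|⟨(Φ₁∘lift)(Φ₂∘lift)⟩ − ⟨Φ₁∘lift⟩⟨Φ₂∘lift⟩| ≤ 32 e^{−κ(ρ)(n − D − 4)} (#T₁·J·M₁E)(#T₂·J·M₂E)`,
`J = 1 + 8·3`, `E = wilsonSmoothLip 2 4 (β_W/2)` (ds-1's `su2Star_abs_integral_mul_sub_le` with the
`StarFront` geometry). -/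
theorem su2Star_torus_far_bound (hL : 1 < L) (βW : ℝ) {ρ : ℝ} (hρ0 : 0 ≤ ρ) (hρ1 : ρ < 1)
    (hS : StarWindowBound L βW ρ suFrobDist)
    {Φ₁ Φ₂ : LGConfig 4 (Matrix.specialUnitaryGroup (Fin 2) ℂ) → ℝ} (h₁m : Measurable Φ₁)
    (h₂m : Measurable Φ₂) {T₁ T₂ : Finset (Literature.MathematicalPhysics.QuantumLattice.ZdEdge 4)} (h₁T : IsCylinder Φ₁ T₁)
    (h₂T : IsCylinder Φ₂ T₂) {M₁ M₂ : ℝ} (hM₁ : ∀ U, |Φ₁ U| ≤ M₁) (hM₂ : ∀ U, |Φ₂ U| ≤ M₂)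
    {n D : ℕ} (hfar : D + 4 ≤ n)
    (hgeom : ∀ a ∈ T₁, ∀ b ∈ T₂, n ≤ torusNorm ((torusEdge L a).1 - (torusEdge L b).1) + D) :
    |(∫ V, toTorusObservable L Φ₁ V * toTorusObservable L Φ₂ V
          ∂(wilsonMeasure (d := 4) (L := L) (fundamentalRep (Fin 2)) (βW / 2))) -
        (∫ V, toTorusObservable L Φ₁ V
          ∂(wilsonMeasure (d := 4) (L := L) (fundamentalRep (Fin 2)) (βW / 2))) *
          ∫ V, toTorusObservable L Φ₂ V
            ∂(wilsonMeasure (d := 4) (L := L) (fundamentalRep (Fin 2)) (βW / 2))| ≤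
      4 * (2 * Real.sqrt 2) ^ 2 * Real.exp (-(starRate ρ * ((n - (D + 4) : ℕ) : ℝ))) *
        ((T₁.card : ℝ) * (((1 + 4 * (2 * (4 - 1)) : ℕ) : ℝ)) * (M₁ * wilsonSmoothLip 2 4 (βW / 2))) *
        ((T₂.card : ℝ) * (((1 + 4 * (2 * (4 - 1)) : ℕ) : ℝ)) * (M₂ * wilsonSmoothLip 2 4 (βW / 2))) := by
  classical
  set μ := wilsonMeasure (d := 4) (L := L) (fundamentalRep (Fin 2)) (βW / 2) with hμdef
  set J : ℝ := ((1 + 4 * (2 * (4 - 1)) : ℕ) : ℝ) with hJdef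
  have hJ0 : 0 ≤ J := by rw [hJdef]; exact Nat.cast_nonneg _
  set E : ℝ := wilsonSmoothLip 2 4 (βW / 2) with hEdef
  have hE0 : 0 ≤ E := wilsonSmoothLip_nonneg (by norm_num) 4 (βW / 2)
  have hM₁0 : 0 ≤ M₁ := (abs_nonneg _).trans (hM₁ fun _ => 1)
  have hM₂0 : 0 ≤ M₂ := (abs_nonneg _).trans (hM₂ fun _ => 1)
  set f : GaugeConfig 4 L (Matrix.specialUnitaryGroup (Fin 2) ℂ) → ℝ := toTorusObservable L Φ₁
  set g : GaugeConfig 4 L (Matrix.specialUnitaryGroup (Fin 2) ℂ) → ℝ := toTorusObservable L Φ₂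
  have hfm : Measurable f := h₁m.comp (measurable_torusLift L)
  have hgm : Measurable g := h₂m.comp (measurable_torusLift L)
  set Δf : Finset (Edge 4 L) := T₁.image (torusEdge L) with hΔf
  set Δg : Finset (Edge 4 L) := T₂.image (torusEdge L) with hΔg
  have hfdep : DependsOn f (↑Δf : Set (Edge 4 L)) := dependsOn_toTorusObservable L h₁T
  have hgdep : DependsOn g (↑Δg : Set (Edge 4 L)) := dependsOn_toTorusObservable L h₂T
  have hMf : ∀ σ, |f σ| ≤ M₁ := fun σ => hM₁ _
  have hMg : ∀ σ, |g σ| ≤ M₂ := fun σ => hM₂ _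
  -- the plaquette closure of `Δf` misses `Δg`
  have hsep : ∀ y ∈ plaqClosure Δf, y ∉ Δg := by
    intro y hy hyg
    obtain ⟨y₀, hy₀, hyy₀⟩ := exists_near_of_mem_plaqClosure hy
    obtain ⟨a, ha, rfl⟩ := Finset.mem_image.1 hy₀
    obtain ⟨b, hb, rfl⟩ := Finset.mem_image.1 hyg
    have h1 : torusNorm ((torusEdge L a).1 - (torusEdge L b).1) ≤ 1 := by
      rw [← torusNorm_neg, neg_sub]; exact hyy₀
    have h2 := hgeom a ha b hb
    omega
  -- the endpoint distance between the two plaquette closures is `≥ n − D − 4`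
  have hL₀ : ∀ y ∈ plaqClosure Δf, ∀ z ∈ plaqClosure Δg, ∀ a ∈ linkEnds y, ∀ w ∈ linkEnds z,
      n - (D + 4) ≤ torusNorm (a - w) := by
    intro y hy z hz a ha w hw
    obtain ⟨y₀, hy₀, hyy₀⟩ := exists_near_of_mem_plaqClosure hy
    obtain ⟨a₀, ha₀, rfl⟩ := Finset.mem_image.1 hy₀
    obtain ⟨z₀, hz₀, hzz₀⟩ := exists_near_of_mem_plaqClosure hz
    obtain ⟨b₀, hb₀, rfl⟩ := Finset.mem_image.1 hz₀
    have h2 := hgeom a₀ ha₀ b₀ hb₀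
    have htri : torusNorm ((torusEdge L a₀).1 - (torusEdge L b₀).1) ≤
        1 + 1 + torusNorm (a - w) + 1 + 1 := by
      calc torusNorm ((torusEdge L a₀).1 - (torusEdge L b₀).1)
          ≤ torusNorm ((torusEdge L a₀).1 - y.1) + torusNorm (y.1 - (torusEdge L b₀).1) :=
            torusNorm_sub_le _ _ _
        _ ≤ torusNorm ((torusEdge L a₀).1 - y.1) + (torusNorm (y.1 - a) +
            torusNorm (a - (torusEdge L b₀).1)) :=
            Nat.add_le_add_left (torusNorm_sub_le _ _ _) _
        _ ≤ torusNorm ((torusEdge L a₀).1 - y.1) + (torusNorm (y.1 - a) +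
            (torusNorm (a - w) + torusNorm (w - (torusEdge L b₀).1))) :=
            Nat.add_le_add_left (Nat.add_le_add_left (torusNorm_sub_le _ _ _) _) _
        _ ≤ torusNorm ((torusEdge L a₀).1 - y.1) + (torusNorm (y.1 - a) +
            (torusNorm (a - w) + (torusNorm (w - z.1) + torusNorm (z.1 - (torusEdge L b₀).1)))) :=
            Nat.add_le_add_left (Nat.add_le_add_left (Nat.add_le_add_left
              (torusNorm_sub_le _ _ _) _) _) _
        _ ≤ 1 + (1 + (torusNorm (a - w) + (1 + 1))) := by
            refine Nat.add_le_add ?_ (Nat.add_le_add (torusNorm_fst_sub_linkEnds_le_one y ha)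
              (Nat.add_le_add_left (Nat.add_le_add ?_ hzz₀) _))
            · rw [← torusNorm_neg, neg_sub]; exact hyy₀
            · rw [← torusNorm_neg, neg_sub]; exact torusNorm_fst_sub_linkEnds_le_one z hw
        _ = 1 + 1 + torusNorm (a - w) + 1 + 1 := by ring
    omega
  have key := su2Star_abs_integral_mul_sub_le hL βW hρ0 hρ1 hS hfm hfdep hMf hgm hgdep hMg hsep
    (n - (D + 4)) hL₀
  rw [← hμdef] at key
  refine key.trans ?_
  have hcardf : ((plaqClosure Δf).card : ℝ) ≤ T₁.card * J := by
    have h1 : ((plaqClosure Δf).card : ℝ) ≤ Δf.card * J := by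
      rw [hJdef]; exact_mod_cast card_plaqClosure_le Δf
    have h2 : (Δf.card : ℝ) ≤ T₁.card := by exact_mod_cast Finset.card_image_le
    exact h1.trans (mul_le_mul_of_nonneg_right h2 hJ0)
  have hcardg : ((plaqClosure Δg).card : ℝ) ≤ T₂.card * J := by
    have h1 : ((plaqClosure Δg).card : ℝ) ≤ Δg.card * J := by
      rw [hJdef]; exact_mod_cast card_plaqClosure_le Δg
    have h2 : (Δg.card : ℝ) ≤ T₂.card := by exact_mod_cast Finset.card_image_le
    exact h1.trans (mul_le_mul_of_nonneg_right h2 hJ0)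
  have hME₁ : 0 ≤ M₁ * E := mul_nonneg hM₁0 hE0
  have hME₂ : 0 ≤ M₂ * E := mul_nonneg hM₂0 hE0
  have hY : 0 ≤ (T₂.card : ℝ) * J * (M₂ * E) := by positivity
  have hX : 0 ≤ 4 * (2 * Real.sqrt 2) ^ 2 * Real.exp (-(starRate ρ * ((n - (D + 4) : ℕ) : ℝ))) := by
    positivity
  gcongr

end Torus

/-! ### The door for infinite-volume limit states -/

section Limit

/-- **Weak-limit step**: a covariance bound valid on every large torus of the defining subsequence
passes to the infinite-volume limit state, for bounded CONTINUOUS cylinder observables `Φ₁, Φ₂` of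
`ℤ⁴` whose supports (with collars) `T₁`, `T₂ − x`... are far apart: if every torus of side `L ≥ L₁`
carries `StarWindowBound L β_W ρ suFrobDist` (`ρ < 1`), `μ` is the limit of the torus Wilson states
along `L_k + 1`, and `‖a − (b + x)‖_∞ ≤ D` for all base points `a` of `T₁`, `b` of `T₂` with
`‖x‖_∞ ≥ D + 4`, then
`|μ(Φ₁Φ₂) − μ(Φ₁)μ(Φ₂)| ≤ 32 e^{−κ(ρ)(‖x‖_∞ − D − 4)} (#T₁·J·M₁E)(#T₂·J·M₂E)`. -/
theorem su2Star_limit_far_bound (βW : ℝ) {ρ : ℝ} (hρ0 : 0 ≤ ρ) (hρ1 : ρ < 1) (L₁ : ℕ)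
    (hS : ∀ (L : ℕ) [NeZero L], L₁ ≤ L → StarWindowBound L βW ρ suFrobDist)
    {μ : Measure (LGConfig 4 (Matrix.specialUnitaryGroup (Fin 2) ℂ))} {Lseq : ℕ → ℕ}
    (hLmono : StrictMono Lseq)
    (hμL : IsInfiniteVolumeLimitAlong (d := 4) (fundamentalRep (Fin 2)) (βW / 2) Lseq μ)
    {Φ₁ Φ₂ : LGConfig 4 (Matrix.specialUnitaryGroup (Fin 2) ℂ) → ℝ} (h₁c : Continuous Φ₁)
    (h₂c : Continuous Φ₂) (h₁m : Measurable Φ₁) (h₂m : Measurable Φ₂)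
    {T₁ T₂ : Finset (Literature.MathematicalPhysics.QuantumLattice.ZdEdge 4)} (h₁T : IsCylinder Φ₁ T₁)
    (h₂T : IsCylinder Φ₂ T₂) {M₁ M₂ : ℝ} (hM₁ : ∀ U, |Φ₁ U| ≤ M₁) (hM₂ : ∀ U, |Φ₂ U| ≤ M₂)
    (x : Literature.Probability.LatticeModels.Site 4) {D : ℕ}
    (hxD : ∀ a ∈ T₁, ∀ b ∈ T₂,
      Literature.Probability.LatticeModels.Site.supNorm (a.1 - (b.1 + x)) ≤ D)
    (hfar : D + 4 ≤ Literature.Probability.LatticeModels.Site.supNorm x) :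
    |(∫ U, Φ₁ U * Φ₂ U ∂μ) - (∫ U, Φ₁ U ∂μ) * ∫ U, Φ₂ U ∂μ| ≤
      4 * (2 * Real.sqrt 2) ^ 2 *
        Real.exp (-(starRate ρ *
          ((Literature.Probability.LatticeModels.Site.supNorm x - (D + 4) : ℕ) : ℝ))) *
        ((T₁.card : ℝ) * (((1 + 4 * (2 * (4 - 1)) : ℕ) : ℝ)) * (M₁ * wilsonSmoothLip 2 4 (βW / 2))) *
        ((T₂.card : ℝ) * (((1 + 4 * (2 * (4 - 1)) : ℕ) : ℝ)) * (M₂ * wilsonSmoothLip 2 4 (βW / 2))) := by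
  obtain ⟨hprob, hlim⟩ := hμL
  set nx : ℕ := Literature.Probability.LatticeModels.Site.supNorm x with hnx
  -- the three torus expectations converge
  have hP : IsCylinder (fun U => Φ₁ U * Φ₂ U) (T₁ ∪ T₂) := IsCylinder.mul h₁T h₂T
  have t1 := hlim (fun U => Φ₁ U * Φ₂ U) _ hP (h₁c.mul h₂c)
    ⟨M₁ * M₂, fun U => abs_mul_le_of_abs_le hM₁ hM₂ U⟩
  have t2 := hlim Φ₁ T₁ h₁T h₁c ⟨M₁, hM₁⟩
  have t3 := hlim Φ₂ T₂ h₂T h₂c ⟨M₂, hM₂⟩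
  have t := (t1.sub (t2.mul t3)).abs
  refine le_of_tendsto t ?_
  -- the bound on every large torus of the subsequence
  filter_upwards [eventually_ge_atTop (max L₁ (2 * nx))] with k hk
  have hkL : max L₁ (2 * nx) ≤ Lseq k := hk.trans hLmono.le_apply
  have hL1 : 1 < Lseq k + 1 := by omega
  have hxL : 2 * Literature.Probability.LatticeModels.Site.supNorm x < Lseq k + 1 := by
    rw [← hnx]; omega
  have hSW := hS (Lseq k + 1) (by omega)
  have hgeom : ∀ a ∈ T₁, ∀ b ∈ T₂,
      nx ≤ torusNorm ((torusEdge (Lseq k + 1) a).1 - (torusEdge (Lseq k + 1) b).1) + D := by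
    intro a ha b hb
    have hs := supNorm_le_torusNorm_add (L := Lseq k + 1) (a := a.1) (b := b.1 + x) hxL
    rw [add_sub_cancel_right] at hs
    exact hs.trans (Nat.add_le_add_left (hxD a ha b hb) _)
  have h := su2Star_torus_far_bound hL1 βW hρ0 hρ1 hSW h₁m h₂m h₁T h₂T hM₁ hM₂ hfar hgeom
  unfold wilsonExpectation
  exact h

/-- Base points of `S₁ ∪ collar S₁` and of `(S₂ − x) ∪ collar(S₂ − x)`, the latter translated back by
`x`, are within `D + 2` of each other in the sup norm, where `D` bounds `‖a₀ − b₀‖_∞` over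
`S₁ × S₂`. -/
theorem supNorm_le_of_mem_union_collar
    {S₁ S₂ : Finset (Literature.MathematicalPhysics.QuantumLattice.ZdEdge 4)} {D : ℕ}
    (hD : ∀ a₀ ∈ S₁, ∀ b₀ ∈ S₂,
      Literature.Probability.LatticeModels.Site.supNorm (a₀.1 - b₀.1) ≤ D)
    (x : Literature.Probability.LatticeModels.Site 4)
    {a b : Literature.MathematicalPhysics.QuantumLattice.ZdEdge 4}
    (ha : a ∈ S₁ ∪ (plaquettesTouching S₁).biUnion plaquetteEdges)
    (hb : b ∈ S₂.image (fun e => (e.1 - x, e.2)) ∪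
      (plaquettesTouching (S₂.image fun e => (e.1 - x, e.2))).biUnion plaquetteEdges) :
    Literature.Probability.LatticeModels.Site.supNorm (a.1 - (b.1 + x)) ≤ D + 2 := by
  obtain ⟨a₀, ha₀, hna⟩ := exists_near_of_mem_union_collar ha
  obtain ⟨b₀', hb₀', hnb⟩ := exists_near_of_mem_union_collar hb
  obtain ⟨b₀, hb₀, rfl⟩ := Finset.mem_image.1 hb₀'
  have hDab := hD a₀ ha₀ b₀ hb₀
  rw [Literature.Probability.LatticeModels.Site.supNorm_le_iff]
  intro j
  have h1 := hna j
  have h2 := hnb j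
  have h3 := (Literature.Probability.LatticeModels.Site.natAbs_le_supNorm (a₀.1 - b₀.1) j).trans hDab
  simp only [Pi.sub_apply, Pi.add_apply] at h1 h2 h3 ⊢
  rw [abs_le] at h1 h2
  omega

end Limit

end Summit.Ventures.YMGap.StarLimit

end
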